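import Mathlib
import Literature.NumberTheory.Irrationality.LaiSprangZudilin2026.PadicPoleSeries
import Literature.NumberTheory.Irrationality.LaiYu2020.ProgressionValuation
import HarnessLib

/-!
# Lai 2025 (IJNT, `2`-adic zeta values), §3–§4 at `s = 0`: the rational function
# `B_n(t) = 2^{6n}(t+¾)_n²/(t)_{n+1}²`, its partial fractions, and `d_n^{2−i} b_{n,i,k} ∈ ℤ` — PROVED

Topic `Literature/NumberTheory/Irrationality/Lai2025TwoAdic`.  Source: L. Lai, *On the irrationality of certain
`2`-adic zeta values*, Int. J. Number Theory (2025) = arXiv:2304.00816 [Lai2025TwoAdicZeta] (held text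
`paper:arxiv-2304.00816`, chunks p0007–p0008 = §3 "Rational functions and linear forms" and §4 "Arithmetic
properties of the coefficients", read on the page).  PROOF FILE (definitions with bodies + theorems; no named fact,
net debt 0).  It is file 1 of the tree's discharge of [Calegari2005, Thm 3.3] (`ζ₂(3) ∉ ℚ`, tree fact
`PAdicZetaValues.calegari2005_theorem33`) along the printed alternative proof «The special case `s = 0` of Theorem 1.3
gives an alternative proof of the irrationality of `ζ₂(3)`» ([Lai2025TwoAdicZeta, §1, after Thm 1.3]).

## Source, as printed (the case `s = 0` is what is formalised)

* **Definition 3.1.** «Fix a nonnegative integer `s` … For every positive integer `n` we define …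
  `B_n(t) := 2^{(3s+6)n} · (t+¾)_n^{s+2}/(t)_{n+1}^{s+2}` … Both `A_n(t)` and `B_n(t)` have degree `≤ −2`.  We define
  their partial fraction decompositions by … `B_n(t) =: Σ_{i=1}^{s+2} Σ_{k=0}^{n} b_{n,i,k}/(t+k)^i` [(def_b)].»
* **Lemma 4.1** (with `F_{3/4}(t) := 2^{3n}(t+¾)_n/n!`, `G(t) := n!/(t)_{n+1}`): «for any integer `k ∈ [0,n]` and any
  nonnegative integer `ℓ`, we have `d_n^ℓ · (1/ℓ!) F_{3/4}^{(ℓ)}(t)|_{t=−k} ∈ ℤ`, `d_n^ℓ · (1/ℓ!)((t+k)G(t))^{(ℓ)}|_{t=−k} ∈ ℤ`.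
  *Proof.* These are well-known … [LY20] for [the `F`'s]; … [Zud04] for [`(t+k)G`].»
* **Lemma 4.2.** «`d_n^{s+2−i} b_{n,i,k} ∈ ℤ (1 ≤ i ≤ s+2, 0 ≤ k ≤ n)`.  *Proof.* …
  `b_{n,i,k} = (1/(s+2−i)!) ((t+k)^{s+2}B_n(t))^{(s+2−i)}|_{t=−k}` … `(t+k)^{s+2}B_n(t) = F_{3/4}(t)^{s+2}((t+k)G(t))^{s+2}`,
  the Leibniz rule and Lemma 4.1.»
* (From the proof of Lemma 3.3:) «we have `σ_{n,1} = 0` since `deg B_n(t) ≤ −2`» — i.e. `Σ_k b_{n,1,k} = 0`.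

## What is formalised (all PROVED; `s = 0`, so `s + 2 = 2`)

* `quarterBrick a n t = 2^{3n}(t + a/4)_n/n!` (`a ∈ ℤ`; `a = 3` is `F_{3/4}`, `a = 1` is `F_{1/4}`): an
  INTEGER-VALUED polynomial of degree `n` (its value at an integer `k` is `2ⁿ∏_{j<n}(4k+a+4j)/n!`, and `n!` divides
  `2ⁿ` times any `n`-term integer progression of difference `4` — the tree's
  `LaiYu2020.factorial_dvd_primeFactors_pow_mul_prod_progression`, i.e. [LY20, Prop. 3.1–3.2]); hence Lemma 4.1 for `F_{a/4}`:
  `quarterBrick_isDInt` — `d_n^ℓ (1/ℓ!) F_{a/4}^{(ℓ)}(k) ∈ ℤ` at every integer `k` (integer-valued polynomials are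
  `IsDInt (d_n)`, tree `RivoalZudilin2020.isDInt_eval_of_intValued`).
* `B n` = Definition 3.1 at `s = 0`; `Breg n k = F_{3/4}² · ((t+k)G)²` = `(t+k)²B_n(t)` in brick form, regular at `−k`
  (`Breg_eq`; `(t+k)G(t)` is the tree's `RivoalZudilin2020.Greg`, Lemma 4.1 for it = `Greg_isDInt`); `Breg_isDInt`.
* `coeffB n i k := 𝒟_{2−i}(Breg n k)(−k)` = `b_{n,i,k}` of (def_b) (identified analytically, `coeffB_eq_of_pfEval`);
  the expansion (def_b) off the poles (`B_eq_sum_coeffB`); **Lemma 4.2** `exists_int_lcm_pow_mul_coeffB`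
  (`d_n^{2−i}b_{n,i,k} ∈ ℤ`); the closed form `coeffB_two_eq` of `b_{n,2,k}` and the bound `coeffB_two_le`
  (`0 ≤ b_{n,2,k} ≤ 2^{6n}`, the `s = 0` instance of the estimate in the proof of Lemma 5.2).

The linear forms `T_n` (Definition 3.2, Lemma 3.3) and `Σ_k b_{n,1,k} = 0` are in the sibling `LinearFormsT.lean`.
Cell zeta5-irr / pub-zeta5 (HONEST FRAMING: systematic search; no irrationality claim unless kernel-certified):
`2`-adic preliminaries for `ζ₂(3)`; nothing here bears on `ζ(5) ∈ ℝ`.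
-/

noncomputable section

open Finset Filter Polynomial Literature.Analysis.Calculus
open Literature.NumberTheory.Transcendental
open Literature.NumberTheory.Irrationality.RivoalZudilin2020 (Greg Greg_eq Greg_isDInt isDInt_eval_of_intValued)
open Literature.NumberTheory.Irrationality.LaiSprangZudilin2026 (divDeriv_eq_coeff_of_pfEval)
open Literature.NumberTheory.Irrationality.LaiSprangZudilin2026.Lemma53 (Greg_neg)
open scoped Nat Topology

namespace Literature.NumberTheory.Irrationality.Lai2025TwoAdic

/-! ## §1. The quarter-integer brick `F_{a/4}(t) = 2^{3n}(t + a/4)_n/n!` (Lemma 4.1) -/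

/-- The QUARTER-INTEGER BRICK `quarterBrick a n t = 2^{3n} (t + a/4)(t + a/4 + 1)⋯(t + a/4 + n − 1)/n!` (`a ∈ ℤ`):
Lai's `F_{1/4}` (`a = 1`) and `F_{3/4}` (`a = 3`). [cite: Lai2025TwoAdicZeta, Lemma 4.1 (F_{1/4}, F_{3/4})] -/
def quarterBrick (a : ℤ) (n : ℕ) (t : ℚ) : ℚ :=
  (2 : ℚ) ^ (3 * n) / (n ! : ℚ) * ∏ j ∈ range n, (t + ((a : ℚ) / 4 + j))

/-- The quarter-integer brick as a polynomial. [cite: Lai2025TwoAdicZeta, Lemma 4.1] -/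
def quarterBrickPoly (a : ℤ) (n : ℕ) : ℚ[X] :=
  C ((2 : ℚ) ^ (3 * n) / (n ! : ℚ)) * ∏ j ∈ range n, (X + C ((a : ℚ) / 4 + j))

/-- `quarterBrickPoly` evaluates to `quarterBrick`. [cite: Lai2025TwoAdicZeta, Lemma 4.1] -/
theorem eval_quarterBrickPoly (a : ℤ) (n : ℕ) (t : ℚ) : (quarterBrickPoly a n).eval t = quarterBrick a n t := by
  rw [quarterBrickPoly, quarterBrick, eval_mul, eval_C, eval_prod]
  congr 1
  exact prod_congr rfl fun j _ => by rw [eval_add, eval_X, eval_C]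

/-- `deg quarterBrickPoly a n ≤ n`. [cite: Lai2025TwoAdicZeta, Lemma 4.1] -/
theorem natDegree_quarterBrickPoly_le (a : ℤ) (n : ℕ) : (quarterBrickPoly a n).natDegree ≤ n := by
  unfold quarterBrickPoly
  refine natDegree_mul_le.trans ?_
  rw [natDegree_C, zero_add]
  refine (natDegree_prod_le _ _).trans ?_
  refine (sum_le_sum fun j _ => (natDegree_X_add_C _).le).trans ?_
  simp

/-- The value of the quarter-integer brick at an integer `k`:
`quarterBrick a n k = 2ⁿ ∏_{j<n} (4k + a + 4j) / n!`. [cite: Lai2025TwoAdicZeta, Lemma 4.1 (proof: "well-known … [LY20]")] -/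
theorem quarterBrick_intCast (a : ℤ) (n : ℕ) (k : ℤ) :
    quarterBrick a n k = ((2 : ℤ) ^ n * ∏ j ∈ range n, (4 * k + a + 4 * (j : ℤ)) : ℤ) / (n ! : ℚ) := by
  rw [quarterBrick]
  have h4 : ∀ j ∈ range n, ((k : ℚ) + ((a : ℚ) / 4 + j)) = (1 / 4) * (4 * k + a + 4 * j) :=
    fun j _ => by ring
  rw [prod_congr rfl h4, prod_mul_distrib, prod_const, card_range]
  push_cast
  have : (2 : ℚ) ^ (3 * n) * (1 / 4) ^ n = 2 ^ n := by
    rw [pow_mul, ← mul_pow]; norm_num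
  rw [div_mul_eq_mul_div, ← mul_assoc, this]

/-- `4 = 2²` has the single prime factor `2`. [folklore] -/
private theorem primeFactors_four : (4 : ℕ).primeFactors = {2} := by
  rw [show (4 : ℕ) = 2 ^ 2 by norm_num, Nat.primeFactors_prime_pow (by norm_num) Nat.prime_two]

/-- The quarter-integer brick takes INTEGER values at integers: `n! ∣ 2ⁿ∏_{j<n}(N + 4j)` for every integer `N`
([LY20, Prop. 3.1–3.2]: the progression part is divisible by `q^{v_q(n!)}` for odd `q`, and `v₂(n!) ≤ n`).
[cite: Lai2025TwoAdicZeta, Lemma 4.1 (F_{1/4}, F_{3/4}), case ℓ = 0] -/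
theorem quarterBrick_intCast_isInt (a : ℤ) (n : ℕ) (k : ℤ) : ∃ z : ℤ, quarterBrick a n k = z := by
  have h := LaiYu2020.factorial_dvd_primeFactors_pow_mul_prod_progression 4 (by norm_num) (4 * k + a) n
  rw [primeFactors_four, prod_singleton] at h
  have h2 : ((2 : ℕ) : ℤ) ^ (n / (2 - 1)) = 2 ^ n := by norm_num
  rw [h2] at h
  obtain ⟨w, hw⟩ := h
  push_cast at hw
  refine ⟨w, ?_⟩
  rw [quarterBrick_intCast]
  have e : ∀ j ∈ range n, (4 * k + a + 4 * (j : ℤ)) = (4 * k + a) + (j : ℤ) * 4 := fun j _ => by ring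
  rw [prod_congr rfl e, hw]
  have hf : (n ! : ℚ) ≠ 0 := by exact_mod_cast Nat.factorial_ne_zero n
  push_cast
  field_simp

/-- **Lemma 4.1 for `F_{1/4}`, `F_{3/4}`**: the quarter-integer brick is `IsDInt (d_n)` at every integer —
`d_n^ℓ · (1/ℓ!) F_{a/4}^{(ℓ)}(k) ∈ ℤ` for all `ℓ` (an integer-valued polynomial of degree `n`).
[cite: Lai2025TwoAdicZeta, Lemma 4.1 (the inclusions for F_{1/4}, F_{3/4})] -/
theorem quarterBrick_isDInt (a : ℤ) (n : ℕ) (k : ℤ) (N : ℕ) :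
    IsDInt (Nat.lcmUpto n) N (quarterBrick a n) k := by
  have h := isDInt_eval_of_intValued (quarterBrickPoly a n) (natDegree_quarterBrickPoly_le a n)
    (fun i _ => by rw [eval_quarterBrickPoly]; exact_mod_cast quarterBrick_intCast_isInt a n i) k N
  refine h.congr (Eventually.of_forall fun t => ?_)
  exact eval_quarterBrickPoly a n t

/-- The quarter-integer brick (a polynomial) is smooth everywhere. [cite: Lai2025TwoAdicZeta, Lemma 4.1 (F_{1/4}, F_{3/4} are polynomials)] -/
theorem contDiffAt_quarterBrick (a : ℤ) (n : ℕ) (x : ℚ) {N : WithTop ℕ∞} :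
    ContDiffAt ℚ N (quarterBrick a n) x := by
  unfold quarterBrick
  fun_prop

/-! ## §2. Definition 3.1 (`s = 0`): `B_n(t) = 2^{6n}(t+¾)_n²/(t)_{n+1}²` and its brick form -/

/-- **Definition 3.1** at `s = 0`: `B_n(t) := 2^{6n} · (t+¾)_n² / (t)_{n+1}²` (degree `2n − 2(n+1) = −2`).
[cite: Lai2025TwoAdicZeta, Definition 3.1 (B_n(t))] -/
def B (n : ℕ) (t : ℚ) : ℚ :=
  (2 : ℚ) ^ (6 * n) * (∏ j ∈ range n, (t + 3 / 4 + j)) ^ 2 / (∏ j ∈ range (n + 1), (t + j)) ^ 2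

/-- The BRICK FORM of `(t+k)²B_n(t)`, regular at `t = −k`: `F_{3/4}(t)² · ((t+k)G(t))²` with
`F_{3/4} = quarterBrick 3 n`, `(t+k)G(t) = n!(t+k)/(t)_{n+1} = Greg n k`. [cite: Lai2025TwoAdicZeta, Lemma 4.2 (proof: "(t+k)^{s+2}B_n(t) = F_{3/4}^{s+2}((t+k)G)^{s+2}")] -/
def Breg (n k : ℕ) (t : ℚ) : ℚ :=
  quarterBrick 3 n t ^ 2 * Greg n k t ^ 2

/-- `Greg n k t = n! · (t+k) · ∏_{l ≤ n} (t+l)⁻¹` off `t = −k` (any `k`): the regularised `(t+k)G(t)`, `G(t) = n!/(t)_{n+1}`.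
[cite: Lai2025TwoAdicZeta, Lemma 4.1 (G(t) = n!/(t)_{n+1})] -/
theorem Greg_eq_mul_prod_inv (n k : ℕ) {t : ℚ} (htk : t + k ≠ 0) :
    Greg n k t = (n ! : ℚ) * (t + k) * ∏ l ∈ range (n + 1), (t + l)⁻¹ := by
  unfold Greg
  rw [recipBrickReg_eq 0 (n + 1) (k : ℤ) (by exact_mod_cast htk), recipBrick, Nat.add_sub_cancel]
  push_cast
  simp only [zero_add]
  ring

/-- Off the poles `0, −1, …, −n` and off `−k`: `Breg n k t = B_n(t)·(t+k)²`.
[cite: Lai2025TwoAdicZeta, Lemma 4.2 (proof)] -/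
theorem Breg_eq (n k : ℕ) {t : ℚ} (ht : ∀ j ∈ range (n + 1), t + j ≠ 0) (htk : t + k ≠ 0) :
    Breg n k t = B n t * (t + k) ^ 2 := by
  have hprod : ∏ j ∈ range (n + 1), (t + j) ≠ 0 := prod_ne_zero_iff.2 ht
  have hfac : (n ! : ℚ) ≠ 0 := by exact_mod_cast Nat.factorial_ne_zero n
  unfold Breg B quarterBrick
  rw [Greg_eq_mul_prod_inv n k htk, prod_inv_distrib]
  have e : ∏ j ∈ range n, (t + (((3 : ℤ) : ℚ) / 4 + j)) = ∏ j ∈ range n, (t + 3 / 4 + j) :=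
    prod_congr rfl fun j _ => by push_cast; ring
  rw [e, show (2 : ℚ) ^ (6 * n) = (2 ^ (3 * n)) ^ 2 by rw [← pow_mul]; ring_nf]
  field_simp

/-- `Greg n k` (= `(t+k)G(t)` regularised) is smooth at every `x` off the poles `−l`, `l ≤ n`, `l ≠ k`.
[cite: Lai2025TwoAdicZeta, Lemma 4.1 (G(t) = n!/(t)_{n+1}; (t+k)G(t) is regular at −k)] -/
theorem contDiffAt_Greg (n k : ℕ) {x : ℚ} (hx : ∀ l ∈ range (n + 1), l ≠ k → x + l ≠ 0) {N : WithTop ℕ∞} :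
    ContDiffAt ℚ N (Greg n k) x := by
  unfold Greg recipBrickReg
  refine (contDiffAt_const.mul (contDiffAt_prod fun l hl => ?_)).mul ?_
  · have hl' := mem_filter.1 hl
    refine contDiffAt_inv_add_const ?_
    have hlk : l ≠ k := fun h => hl'.2 (by simp [h])
    have := hx l hl'.1 hlk
    push_cast
    simpa using this
  · split_ifs
    · exact contDiffAt_const
    · fun_prop

/-- `Breg n k` is smooth at every `x` off the poles other than `−k`. [cite: Lai2025TwoAdicZeta, Lemma 4.2 (proof)] -/
theorem contDiffAt_Breg (n k : ℕ) {x : ℚ} (hx : ∀ l ∈ range (n + 1), l ≠ k → x + l ≠ 0)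
    {N : WithTop ℕ∞} : ContDiffAt ℚ N (Breg n k) x := by
  unfold Breg
  exact ((contDiffAt_quarterBrick 3 n x).pow 2).mul ((contDiffAt_Greg n k hx).pow 2)

/-- `−k` is off the other poles. [folklore] -/
private theorem neg_add_ne_zero_of_ne {k l : ℕ} (h : l ≠ k) : (-(k : ℚ)) + l ≠ 0 := by
  rw [show (-(k : ℚ) + l) = ((l : ℤ) - (k : ℤ) : ℤ) by push_cast; ring]
  exact_mod_cast sub_ne_zero.2 (by exact_mod_cast h : (l : ℤ) ≠ k)

/-- `Breg n k` is smooth at `−k`. [cite: Lai2025TwoAdicZeta, Lemma 4.2 (proof)] -/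
theorem contDiffAt_Breg_neg (n k : ℕ) {N : WithTop ℕ∞} : ContDiffAt ℚ N (Breg n k) (-(k : ℚ)) :=
  contDiffAt_Breg n k fun _ _ hl => neg_add_ne_zero_of_ne hl

/-- **`d_n^j · 𝒟_j((t+k)²B_n(t))(−k) ∈ ℤ`** for all `j` (`k ≤ n`): Leibniz over the bricks `F_{3/4}` (an
integer-valued polynomial, Lemma 4.1) and `(t+k)G(t)` ([Zud04], Lemma 4.1). [cite: Lai2025TwoAdicZeta, Lemma 4.2 (proof)] -/
theorem Breg_isDInt (n : ℕ) {k : ℕ} (hk : k ≤ n) (N : ℕ) :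
    IsDInt (Nat.lcmUpto n) N (Breg n k) (-(k : ℚ)) := by
  have hF : IsDInt (Nat.lcmUpto n) N (quarterBrick 3 n) (-(k : ℚ)) := by
    simpa using quarterBrick_isDInt 3 n (-(k : ℤ)) N
  exact (hF.pow 2).mul ((Greg_isDInt n hk N).pow 2)

/-! ## §3. The coefficients `b_{n,i,k}` of (def_b) and Lemma 4.2 -/

/-- The coefficient `b_{n,i,k}` of (def_b), DEFINED as the Taylor coefficient `𝒟_{2−i}((t+k)²B_n(t))|_{t=−k}` of the
brick form («`b_{n,i,k} = (1/(s+2−i)!)((t+k)^{s+2}B_n(t))^{(s+2−i)}|_{t=−k}`», `s = 0`).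
[cite: Lai2025TwoAdicZeta, Definition 3.1 (def_b) and Lemma 4.2 (proof, first display)] -/
def coeffB (n i k : ℕ) : ℚ := divDeriv (2 - i) (Breg n k) (-(k : ℚ))

/-- **Lemma 4.2 at `s = 0`:** `d_n^{2−i} · b_{n,i,k} ∈ ℤ` (`k ≤ n`). [cite: Lai2025TwoAdicZeta, Lemma 4.2 (the inclusion for b_{n,i,k})] -/
theorem exists_int_lcm_pow_mul_coeffB (n : ℕ) {k : ℕ} (hk : k ≤ n) (i : ℕ) :
    ∃ z : ℤ, (Nat.lcmUpto n : ℚ) ^ (2 - i) * coeffB n i k = z :=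
  (Breg_isDInt n hk (2 - i)).isInt (2 - i) le_rfl

/-- In particular `b_{n,2,k} ∈ ℤ` (`k ≤ n`). [cite: Lai2025TwoAdicZeta, Lemma 4.2 (i = s+2)] -/
theorem exists_int_coeffB_two (n : ℕ) {k : ℕ} (hk : k ≤ n) : ∃ z : ℤ, coeffB n 2 k = z := by
  simpa using exists_int_lcm_pow_mul_coeffB n hk 2

/-! ### Existence of the expansion (def_b) and identification of its coefficients -/

/-- The list of shifts `0, …, n`, each with multiplicity `2` (the linear factors of `(t)_{n+1}²`). [folklore] -/
def shifts2 (n : ℕ) : List ℕ := (range (n + 1)).toList ++ (range (n + 1)).toList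

/-- `|shifts2 n| = 2(n+1)`. [folklore] -/
private theorem length_shifts2 (n : ℕ) : (shifts2 n).length = 2 * (n + 1) := by
  simp only [shifts2, List.length_append, Finset.length_toList, card_range]
  ring

/-- Every shift is `≤ n`. [folklore] -/
private theorem mem_range_of_mem_shifts2 {n i : ℕ} (hi : i ∈ shifts2 n) : i ∈ range (n + 1) := by
  simp only [shifts2, List.mem_append, Finset.mem_toList, or_self] at hi
  exact hi

/-- Every shift occurs at most twice. [folklore] -/
private theorem count_shifts2_le (n i : ℕ) : (shifts2 n).count i ≤ 2 := by
  have h1 : (range (n + 1)).toList.count i ≤ 1 :=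
    List.nodup_iff_count_le_one.1 (Finset.nodup_toList _) i
  simp only [shifts2, List.count_append]
  omega

/-- `∏_{i ∈ shifts2 n} (t+i)⁻¹ = (∏_{j ≤ n} (t+j))⁻²`. [folklore] -/
private theorem prod_shifts2 (n : ℕ) (t : ℚ) :
    ((shifts2 n).map fun i : ℕ => (t + (i : ℚ))⁻¹).prod = ((∏ j ∈ range (n + 1), (t + j)) ^ 2)⁻¹ := by
  have h1 : (((range (n + 1)).toList).map fun i : ℕ => (t + (i : ℚ))⁻¹).prod
      = (∏ j ∈ range (n + 1), (t + j))⁻¹ := by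
    rw [Finset.prod_map_toList, prod_inv_distrib]
  simp only [shifts2, List.map_append, List.prod_append, h1]
  ring

/-- A bound on the degree of `∏_{j<n}(X + u_j)`. [folklore] -/
private theorem natDegree_prod_X_add_C_le (n : ℕ) (u : ℕ → ℚ) :
    (∏ j ∈ range n, (X + C (u j) : ℚ[X])).natDegree ≤ n := by
  refine (natDegree_prod_le _ _).trans ?_
  refine (sum_le_sum (g := fun _ => 1) fun j _ => (natDegree_X_add_C _).le).trans ?_
  simp

/-- EXISTENCE of an expansion of `B_n` with poles of order `≤ 2` at `0, −1, …, −n` and no polynomial part: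
the numerator `2^{6n}(t+¾)_n²` has degree `2n < 2(n+1)` («`B_n(t)` has degree `≤ −2`»; tree:
`exists_pfEval_eq_eval_mul_prod_inv`). [cite: Lai2025TwoAdicZeta, Definition 3.1 (def_b: the partial fractions of B_n)] -/
theorem exists_B_eq_pfEval (n : ℕ) : ∃ c : ℕ → ℕ → ℚ, ∀ t : ℚ,
    (∀ i ∈ range (n + 1), t + i ≠ 0) → B n t = pfEval (range (n + 1)) (fun _ => 2) c t := by
  classical
  set P : ℚ[X] := C ((2 : ℚ) ^ (6 * n)) * (∏ j ∈ range n, (X + C ((3 : ℚ) / 4 + j))) ^ 2 with hP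
  have hdegP : P.natDegree ≤ 2 * n := by
    have h1 := (natDegree_pow_le (p := ∏ j ∈ range n, (X + C ((3 : ℚ) / 4 + j))) (n := 2)).trans
      (Nat.mul_le_mul_left 2 (natDegree_prod_X_add_C_le n fun j => (3 : ℚ) / 4 + j))
    exact (natDegree_C_mul_le _ _).trans h1
  have hdeg : P.natDegree < (shifts2 n).length := by rw [length_shifts2]; omega
  obtain ⟨c, hc⟩ := exists_pfEval_eq_eval_mul_prod_inv (range (n + 1)) P (shifts2 n)
    (fun i hi => mem_range_of_mem_shifts2 hi) hdeg
  have hPeval : ∀ t : ℚ, P.eval t = 2 ^ (6 * n) * (∏ j ∈ range n, (t + 3 / 4 + j)) ^ 2 := by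
    intro t
    rw [hP]
    simp only [eval_mul, eval_C, eval_pow, eval_prod, eval_add, eval_X]
    congr 2
    exact prod_congr rfl fun j _ => by ring
  have hB : ∀ t : ℚ, B n t = P.eval t * ((shifts2 n).map fun i : ℕ => (t + (i : ℚ))⁻¹).prod := by
    intro t
    rw [prod_shifts2, hPeval, B, div_eq_mul_inv]
  have hPF : IsPF (range (n + 1)) (fun i => (shifts2 n).count i) (B n) :=
    ⟨c, fun t ht => (hB t).trans (hc t ht)⟩
  obtain ⟨c', hc'⟩ := hPF.mono fun i _ => count_shifts2_le n i
  exact ⟨c', hc'⟩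

/-- For ANY expansion `B_n = Σ_{k ≤ n} Σ_{s ≤ 2} c_{k,s}(t+k)^{−s}` off the poles, `c_{k,i} = b_{n,i,k}`
(`k ≤ n`, `1 ≤ i ≤ 2`): the coefficients are the Taylor coefficients of `(t+k)²B_n(t)` at `−k`.
[cite: Lai2025TwoAdicZeta, Definition 3.1 (def_b) and Lemma 4.2 (proof, first display)] -/
theorem coeffB_eq_of_pfEval (n : ℕ) {c : ℕ → ℕ → ℚ}
    (hc : ∀ t : ℚ, (∀ i ∈ range (n + 1), t + i ≠ 0) → B n t = pfEval (range (n + 1)) (fun _ => 2) c t)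
    {k : ℕ} (hk : k ≤ n) {i : ℕ} (hi1 : 1 ≤ i) (hi2 : i ≤ 2) : coeffB n i k = c k i := by
  have hk' : k ∈ range (n + 1) := mem_range.2 (by omega)
  have h := divDeriv_eq_coeff_of_pfEval (T := range (n + 1)) (A := 2) (f := B n) (g := Breg n k)
    (q := fun _ => 0) (c := c) hk' contDiffAt_const (fun t ht => by rw [hc t ht, zero_add])
    (contDiffAt_Breg_neg n k (N := 0)).continuousAt
    (fun t ht => Breg_eq n k ht (ht k hk')) (a := 2 - i) (by omega)
  rw [coeffB, h, show 2 - (2 - i) = i by omega]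

/-- **(def_b) at `s = 0`**: off the poles, `B_n(t) = Σ_{k=0}^{n} Σ_{i=1}^{2} b_{n,i,k} (t+k)^{−i}`.
[cite: Lai2025TwoAdicZeta, Definition 3.1 (the partial-fraction decomposition of B_n)] -/
theorem B_eq_sum_coeffB (n : ℕ) {t : ℚ} (ht : ∀ j ∈ range (n + 1), t + j ≠ 0) :
    B n t = ∑ k ∈ range (n + 1), ∑ i ∈ Icc 1 2, coeffB n i k * ((t + k) ^ i)⁻¹ := by
  obtain ⟨c, hc⟩ := exists_B_eq_pfEval n
  rw [hc t ht, pfEval]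
  refine sum_congr rfl fun k hk => sum_congr rfl fun i hi => ?_
  have hi' := mem_Icc.1 hi
  rw [coeffB_eq_of_pfEval n hc (by have := mem_range.1 hk; omega) hi'.1 hi'.2]

/-! ### The closed form of `b_{n,2,k}` and the bound `0 ≤ b_{n,2,k} ≤ 2^{6n}` -/

/-- `P_k(t) := F_{3/4}(t)·(t+k)G(t)`, so that `(t+k)²B_n(t) = P_k(t)²`. [cite: Lai2025TwoAdicZeta, Lemma 4.2 (proof)] -/
def Pk (n k : ℕ) (t : ℚ) : ℚ := quarterBrick 3 n t * Greg n k t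

/-- `Breg n k = P_k²`. [cite: Lai2025TwoAdicZeta, Lemma 4.2 (proof)] -/
theorem Breg_eq_Pk_sq (n k : ℕ) (t : ℚ) : Breg n k t = Pk n k t ^ 2 := by
  rw [Breg, Pk, mul_pow]

/-- `b_{n,2,k} = P_k(−k)²` (the value of the brick form at `−k`). [cite: Lai2025TwoAdicZeta, Lemma 4.2 (proof: b_{n,i,k} as a Taylor coefficient, i = s+2)] -/
theorem coeffB_two_eq (n k : ℕ) : coeffB n 2 k = Pk n k (-(k : ℚ)) ^ 2 := by
  rw [coeffB, Nat.sub_self, divDeriv_zero, Breg_eq_Pk_sq]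

/-- `0 ≤ b_{n,2,k}`. [cite: Lai2025TwoAdicZeta, Lemma 5.2 (proof, s = 0)] -/
theorem coeffB_two_nonneg (n k : ℕ) : 0 ≤ coeffB n 2 k := by
  rw [coeffB_two_eq]; positivity

/-- `|(−k + ¾)(−k + ¾ + 1)⋯(−k + ¾ + n − 1)| ≤ k!(n−k)!` (`k ≤ n`): each factor is bounded by the corresponding
integer `|j − k|` or `j − k + 1`. [cite: Lai2025TwoAdicZeta, Lemma 5.2 (proof: "max_{|t+k|=1/8}|(t+¾)_n| ≤ k!(n−k)!")] -/
theorem abs_prod_quarter_le (n : ℕ) {k : ℕ} (hk : k ≤ n) :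
    |∏ j ∈ range n, (-(k : ℚ) + ((((3 : ℤ) : ℚ)) / 4 + j))| ≤ (k ! : ℚ) * ((n - k)! : ℚ) := by
  rw [abs_prod, ← prod_range_mul_prod_Ico _ hk]
  have h1 : ∏ j ∈ range k, |(-(k : ℚ) + ((((3 : ℤ) : ℚ)) / 4 + j))| ≤ (k ! : ℚ) := by
    have hle : ∏ j ∈ range k, |(-(k : ℚ) + ((((3 : ℤ) : ℚ)) / 4 + j))| ≤ ∏ j ∈ range k, ((k : ℚ) - j) := by
      refine prod_le_prod (fun j _ => abs_nonneg _) fun j hj => ?_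
      have hj' : (j : ℚ) + 1 ≤ k := by exact_mod_cast (mem_range.1 hj)
      rw [abs_le]; constructor <;> push_cast <;> linarith
    refine hle.trans (le_of_eq ?_)
    rw [← prod_range_reflect, ← prod_range_add_one_eq_factorial, Nat.cast_prod]
    refine prod_congr rfl fun j hj => ?_
    have hj' := mem_range.1 hj
    rw [Nat.cast_sub (by omega : j ≤ k - 1), Nat.cast_sub (by omega : 1 ≤ k)]; push_cast; ring
  have h2 : ∏ j ∈ Ico k n, |(-(k : ℚ) + ((((3 : ℤ) : ℚ)) / 4 + j))| ≤ ((n - k)! : ℚ) := by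
    have hle : ∏ j ∈ Ico k n, |(-(k : ℚ) + ((((3 : ℤ) : ℚ)) / 4 + j))| ≤ ∏ j ∈ Ico k n, ((j : ℚ) - k + 1) := by
      refine prod_le_prod (fun j _ => abs_nonneg _) fun j hj => ?_
      have hj' : (k : ℚ) ≤ j := by exact_mod_cast (mem_Ico.1 hj).1
      rw [abs_le]; constructor <;> push_cast <;> linarith
    refine hle.trans (le_of_eq ?_)
    rw [prod_Ico_eq_prod_range, ← prod_range_add_one_eq_factorial, Nat.cast_prod]
    refine prod_congr rfl fun j _ => ?_
    push_cast; ring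
  have h10 : 0 ≤ ∏ j ∈ range k, |(-(k : ℚ) + ((((3 : ℤ) : ℚ)) / 4 + j))| := prod_nonneg fun _ _ => abs_nonneg _
  have h20 : 0 ≤ ∏ j ∈ Ico k n, |(-(k : ℚ) + ((((3 : ℤ) : ℚ)) / 4 + j))| := prod_nonneg fun _ _ => abs_nonneg _
  exact mul_le_mul h1 h2 h20 (by positivity)

/-- `|F_{3/4}(−k)| ≤ 2^{3n} k!(n−k)!/n!` (`k ≤ n`). [cite: Lai2025TwoAdicZeta, Lemma 5.2 (proof, s = 0)] -/
theorem abs_quarterBrick_three_neg_le (n : ℕ) {k : ℕ} (hk : k ≤ n) :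
    |quarterBrick 3 n (-(k : ℚ))| ≤ (2 : ℚ) ^ (3 * n) * ((k ! : ℚ) * ((n - k)! : ℚ)) / (n ! : ℚ) := by
  have hf : (0 : ℚ) < n ! := by exact_mod_cast Nat.factorial_pos n
  rw [quarterBrick, abs_mul, abs_div, abs_of_pos hf, abs_of_pos (by positivity : (0 : ℚ) < 2 ^ (3 * n)),
    div_mul_eq_mul_div]
  exact div_le_div_of_nonneg_right (mul_le_mul_of_nonneg_left (abs_prod_quarter_le n hk) (by positivity)) hf.le

/-- `|P_k(−k)| ≤ 2^{3n}` (`k ≤ n`): `|F_{3/4}(−k)| ≤ 2^{3n}k!(n−k)!/n!` and `|((t+k)G)(−k)| = n!/(k!(n−k)!)`.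
[cite: Lai2025TwoAdicZeta, Lemma 5.2 (proof, s = 0)] -/
theorem abs_Pk_neg_le (n : ℕ) {k : ℕ} (hk : k ≤ n) : |Pk n k (-(k : ℚ))| ≤ (2 : ℚ) ^ (3 * n) := by
  have hf : (0 : ℚ) < n ! := by exact_mod_cast Nat.factorial_pos n
  have hk1 : (0 : ℚ) < k ! := by exact_mod_cast Nat.factorial_pos k
  have hk2 : (0 : ℚ) < (n - k)! := by exact_mod_cast Nat.factorial_pos (n - k)
  have hG : |Greg n k (-(k : ℚ))| = (n ! : ℚ) / ((k ! : ℚ) * ((n - k)! : ℚ)) := by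
    rw [Greg_neg n hk, abs_div, abs_mul, abs_pow, abs_neg, abs_one, one_pow, one_mul, abs_of_pos hf,
      abs_of_pos (by positivity)]
  rw [Pk, abs_mul, hG]
  calc |quarterBrick 3 n (-(k : ℚ))| * ((n ! : ℚ) / ((k ! : ℚ) * ((n - k)! : ℚ)))
      ≤ (2 : ℚ) ^ (3 * n) * ((k ! : ℚ) * ((n - k)! : ℚ)) / (n ! : ℚ) * ((n ! : ℚ) / ((k ! : ℚ) * ((n - k)! : ℚ))) :=
        mul_le_mul_of_nonneg_right (abs_quarterBrick_three_neg_le n hk) (by positivity)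
    _ = (2 : ℚ) ^ (3 * n) := by field_simp

/-- **`0 ≤ b_{n,2,k} ≤ 2^{6n}`** (`k ≤ n`) — the `s = 0` instance of «`max_{i,k}|b_{n,i,k}| ≤ 2^{(3s+6+o(1))n}`» for
`i = 2` (no `o(1)` needed). [cite: Lai2025TwoAdicZeta, Lemma 5.2 (sigma_est), proof] -/
theorem coeffB_two_le (n : ℕ) {k : ℕ} (hk : k ≤ n) : coeffB n 2 k ≤ (2 : ℚ) ^ (6 * n) := by
  rw [coeffB_two_eq, show (2 : ℚ) ^ (6 * n) = (2 ^ (3 * n)) ^ 2 by rw [← pow_mul]; ring_nf, ← sq_abs]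
  exact pow_le_pow_left₀ (abs_nonneg _) (abs_Pk_neg_le n hk) 2

/-! ### The closed form of `b_{n,1,k}` (a logarithmic derivative) and the bound `|b_{n,1,k}| ≤ 10n·2^{6n}` -/

/-- The logarithmic derivative of a product of non-vanishing linear factors:
`(∏_{i∈u}(t + c_i))' = ∏_{i∈u}(x + c_i) · Σ_{i∈u}(x + c_i)⁻¹` at `t = x`. [folklore] -/
private theorem hasDerivAt_prod_add_const {ι : Type*} [DecidableEq ι] (u : Finset ι) (c : ι → ℚ) {x : ℚ}
    (hx : ∀ i ∈ u, x + c i ≠ 0) :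
    HasDerivAt (fun t : ℚ => ∏ i ∈ u, (t + c i)) ((∏ i ∈ u, (x + c i)) * ∑ i ∈ u, (x + c i)⁻¹) x := by
  have h := HasDerivAt.fun_finsetProd (u := u) (f := fun i (t : ℚ) => t + c i) (f' := fun _ => (1 : ℚ))
    (x := x) fun i _ => (hasDerivAt_id x).add_const (c i)
  refine h.congr_deriv ?_
  rw [mul_sum]
  refine sum_congr rfl fun i hi => ?_
  rw [smul_eq_mul, mul_one, ← mul_prod_erase u (fun j => x + c j) hi]
  have hxi := hx i hi
  field_simp

/-- The logarithmic derivative of a product of reciprocals of non-vanishing linear factors: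
`(∏_{i∈u}(t + c_i)⁻¹)' = −∏_{i∈u}(x + c_i)⁻¹ · Σ_{i∈u}(x + c_i)⁻¹` at `t = x`. [folklore] -/
private theorem hasDerivAt_prod_inv_add_const {ι : Type*} [DecidableEq ι] (u : Finset ι) (c : ι → ℚ) {x : ℚ}
    (hx : ∀ i ∈ u, x + c i ≠ 0) :
    HasDerivAt (fun t : ℚ => ∏ i ∈ u, (t + c i)⁻¹) (-(∏ i ∈ u, (x + c i)⁻¹) * ∑ i ∈ u, (x + c i)⁻¹) x := by
  have h := HasDerivAt.fun_finsetProd (u := u) (f := fun i (t : ℚ) => (t + c i)⁻¹)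
    (f' := fun i => -(1 : ℚ) / (x + c i) ^ 2) (x := x) fun i hi =>
      ((hasDerivAt_id x).add_const (c i)).fun_inv (hx i hi)
  refine h.congr_deriv ?_
  rw [neg_mul, mul_sum, ← sum_neg_distrib]
  refine sum_congr rfl fun i hi => ?_
  have hxi := hx i hi
  rw [smul_eq_mul, ← mul_prod_erase u (fun j => (x + c j)⁻¹) hi]
  field_simp

/-- The logarithmic sum `L_k := Σ_{j<n} (j − k + ¾)⁻¹ − Σ_{l ≤ n, l ≠ k} (l − k)⁻¹`. [cite: Lai2025TwoAdicZeta, Lemma 4.3 (proof: U(t), the logarithmic derivative, here for B_n)] -/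
def logSum (n k : ℕ) : ℚ :=
  ∑ j ∈ range n, (-(k : ℚ) + ((((3 : ℤ) : ℚ)) / 4 + j))⁻¹ -
    ∑ l ∈ (range (n + 1)).filter (fun l => l ≠ k), (-(k : ℚ) + l)⁻¹

/-- The quarter-shifted points are never integers: `−k + ¾ + j ≠ 0` (the zeros `−j − ¾` of `B_n` are off its poles).
[cite: Lai2025TwoAdicZeta, Lemma 4.6 (proof: the roots −1+¼, …, −n+¼ of B_n)] -/
theorem neg_add_quarter_ne_zero (k j : ℕ) : (-(k : ℚ) + ((((3 : ℤ) : ℚ)) / 4 + j)) ≠ 0 := by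
  intro h
  have h4 : (4 * (j : ℤ) - 4 * k + 3 : ℤ) = 0 := by
    have : (4 * (j : ℚ) - 4 * k + 3) = 0 := by push_cast at h; linarith
    exact_mod_cast this
  omega

/-- **The derivative of `P_k` at `−k`** is `P_k(−k)·L_k` (logarithmic derivative of the product form).
[cite: Lai2025TwoAdicZeta, Lemma 4.2 (proof: the Leibniz rule for (t+k)^{s+2}B_n(t))] -/
theorem hasDerivAt_Pk (n : ℕ) {k : ℕ} (hk : k ≤ n) :
    HasDerivAt (Pk n k) (Pk n k (-(k : ℚ)) * logSum n k) (-(k : ℚ)) := by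
  classical
  set S := (range (n + 1)).filter (fun l => l ≠ k) with hS
  have hS' : ∀ l ∈ S, (-(k : ℚ)) + (l : ℚ) ≠ 0 := fun l hl =>
    neg_add_ne_zero_of_ne (mem_filter.1 hl).2
  -- the product form of `P_k`, valid everywhere
  have hform : Pk n k = fun t => (2 : ℚ) ^ (3 * n) *
      ((∏ j ∈ range n, (t + ((((3 : ℤ) : ℚ)) / 4 + j))) * ∏ l ∈ S, (t + l)⁻¹) := by
    funext t
    have hf : (n ! : ℚ) ≠ 0 := by exact_mod_cast Nat.factorial_ne_zero n
    rw [Pk, quarterBrick, Greg_eq n hk t, hS]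
    field_simp
  have hA := hasDerivAt_prod_add_const (range n) (fun j : ℕ => (((3 : ℤ) : ℚ)) / 4 + j) (x := -(k : ℚ))
    fun j _ => neg_add_quarter_ne_zero k j
  have hBi := hasDerivAt_prod_inv_add_const S (fun l : ℕ => (l : ℚ)) (x := -(k : ℚ)) hS'
  have hprod := (hA.mul hBi).const_mul ((2 : ℚ) ^ (3 * n))
  rw [hform]
  refine hprod.congr_deriv ?_
  simp only [logSum]
  ring

/-- **`b_{n,1,k} = 2 b_{n,2,k} · L_k`** (`k ≤ n`): the residue as `P_k(−k)·P_k′(−k)·2`.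
[cite: Lai2025TwoAdicZeta, Lemma 4.2 (proof: b_{n,i,k} as the Taylor coefficient of order s+2−i, i = 1)] -/
theorem coeffB_one_eq (n : ℕ) {k : ℕ} (hk : k ≤ n) : coeffB n 1 k = 2 * coeffB n 2 k * logSum n k := by
  have h1 : coeffB n 1 k = deriv (Breg n k) (-(k : ℚ)) := by
    rw [coeffB, show 2 - 1 = 1 from rfl, divDeriv, iteratedDeriv_one, Nat.factorial_one, Nat.cast_one, div_one]
  have hsq : Breg n k = fun t => Pk n k t ^ 2 := funext (Breg_eq_Pk_sq n k)
  have hd : HasDerivAt (Breg n k) (2 * Pk n k (-(k : ℚ)) * (Pk n k (-(k : ℚ)) * logSum n k)) (-(k : ℚ)) := by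
    rw [hsq]
    refine ((hasDerivAt_Pk n hk).fun_pow 2).congr_deriv ?_
    push_cast
    ring
  rw [h1, hd.deriv, coeffB_two_eq]
  ring

/-- `|L_k| ≤ 5n`: the `n` quarter-shifted terms are `≤ 4` in absolute value, the `n` integer ones `≤ 1`.
[cite: Lai2025TwoAdicZeta, Lemma 5.2 (proof, s = 0)] -/
theorem abs_logSum_le (n : ℕ) {k : ℕ} (hk : k ≤ n) : |logSum n k| ≤ 5 * n := by
  classical
  have h1 : |∑ j ∈ range n, (-(k : ℚ) + ((((3 : ℤ) : ℚ)) / 4 + j))⁻¹| ≤ 4 * n := by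
    refine (abs_sum_le_sum_abs _ _).trans ?_
    have : ∑ j ∈ range n, |(-(k : ℚ) + ((((3 : ℤ) : ℚ)) / 4 + j))⁻¹| ≤ ∑ _j ∈ range n, (4 : ℚ) := by
      refine sum_le_sum fun j _ => ?_
      rw [abs_inv]
      have hq : (1 / 4 : ℚ) ≤ |(-(k : ℚ) + ((((3 : ℤ) : ℚ)) / 4 + j))| := by
        -- `4(j − k) + 3` is an odd integer, so `|j − k + ¾| ≥ ¼`
        have hz : (-(k : ℚ) + ((((3 : ℤ) : ℚ)) / 4 + j)) = ((4 * (j : ℤ) - 4 * k + 3 : ℤ) : ℚ) / 4 := by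
          push_cast; ring
        rw [hz, abs_div, abs_of_pos (by norm_num : (0 : ℚ) < 4)]
        have hne : (4 * (j : ℤ) - 4 * k + 3 : ℤ) ≠ 0 := by omega
        have h1 : (1 : ℚ) ≤ |((4 * (j : ℤ) - 4 * k + 3 : ℤ) : ℚ)| := by
          rw [← Int.cast_abs]; exact_mod_cast Int.one_le_abs hne
        linarith
      calc |(-(k : ℚ) + ((((3 : ℤ) : ℚ)) / 4 + j))|⁻¹ ≤ (1 / 4 : ℚ)⁻¹ :=
            inv_anti₀ (by norm_num) hq
        _ = 4 := by norm_num
    refine this.trans ?_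
    rw [sum_const, card_range, nsmul_eq_mul, mul_comm]
  have h2 : |∑ l ∈ (range (n + 1)).filter (fun l => l ≠ k), (-(k : ℚ) + l)⁻¹| ≤ n := by
    refine (abs_sum_le_sum_abs _ _).trans ?_
    have : ∑ l ∈ (range (n + 1)).filter (fun l => l ≠ k), |(-(k : ℚ) + l)⁻¹|
        ≤ ∑ _l ∈ (range (n + 1)).filter (fun l => l ≠ k), (1 : ℚ) := by
      refine sum_le_sum fun l hl => ?_
      have hlk : l ≠ k := (mem_filter.1 hl).2
      rw [abs_inv]
      have h1 : (1 : ℚ) ≤ |(-(k : ℚ) + l)| := by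
        set z : ℤ := (l : ℤ) - (k : ℤ) with hz
        have hz0 : z ≠ 0 := sub_ne_zero.2 (by exact_mod_cast hlk)
        have hzq : (-(k : ℚ) + l) = (z : ℚ) := by rw [hz]; push_cast; ring
        rw [hzq, ← Int.cast_abs, show (1 : ℚ) = ((1 : ℤ) : ℚ) by norm_num, Int.cast_le]
        exact Int.one_le_abs hz0
      exact inv_le_one_of_one_le₀ h1
    refine this.trans ?_
    rw [sum_const, nsmul_eq_mul, mul_one]
    have hcard : ((range (n + 1)).filter (fun l => l ≠ k)).card = n := by
      rw [filter_ne' (range (n + 1)) k, card_erase_of_mem (mem_range.2 (by omega)), card_range]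
      rfl
    rw [hcard]
  rw [logSum]
  calc |∑ j ∈ range n, (-(k : ℚ) + ((((3 : ℤ) : ℚ)) / 4 + j))⁻¹ -
        ∑ l ∈ (range (n + 1)).filter (fun l => l ≠ k), (-(k : ℚ) + l)⁻¹|
      ≤ |∑ j ∈ range n, (-(k : ℚ) + ((((3 : ℤ) : ℚ)) / 4 + j))⁻¹| +
        |∑ l ∈ (range (n + 1)).filter (fun l => l ≠ k), (-(k : ℚ) + l)⁻¹| := abs_sub _ _
    _ ≤ 4 * n + n := add_le_add h1 h2
    _ = 5 * n := by ring

/-- **`|b_{n,1,k}| ≤ 10n · 2^{6n}`** (`k ≤ n`) — the `s = 0`, `i = 1` instance of Lemma 5.2's coefficient estimate.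
[cite: Lai2025TwoAdicZeta, Lemma 5.2 (sigma_est), proof] -/
theorem abs_coeffB_one_le (n : ℕ) {k : ℕ} (hk : k ≤ n) : |coeffB n 1 k| ≤ 10 * n * (2 : ℚ) ^ (6 * n) := by
  rw [coeffB_one_eq n hk, abs_mul, abs_mul, abs_two, abs_of_nonneg (coeffB_two_nonneg n k)]
  calc 2 * coeffB n 2 k * |logSum n k| ≤ 2 * (2 : ℚ) ^ (6 * n) * (5 * n) :=
        mul_le_mul (mul_le_mul_of_nonneg_left (coeffB_two_le n hk) zero_le_two) (abs_logSum_le n hk)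
          (abs_nonneg _) (by positivity)
    _ = 10 * n * (2 : ℚ) ^ (6 * n) := by ring

/-! ### The value of `B_n` at the quarter-shifted naturals `m + ¼` (input of §6) -/

/-- `(m + 1)(m + 2)⋯(m + n) = n! · binom(m + n, n)` (the step `f = n!^{2+j} binom(t+n,n)^{2+j} ⋯` of §6).
[cite: Lai2025TwoAdicZeta, Lemma 6.2/6.3 (proof: the display for f_{(i_1,…,i_n,j)})] -/
theorem prod_range_add_one_add (m n : ℕ) :
    ∏ j ∈ range n, ((m : ℚ) + 1 + j) = (n ! : ℚ) * ((m + n).choose n : ℚ) := by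
  -- `(m+1)·…·(m+n) = (m+1).ascFactorial n = n! · binom(m+n, n)`
  have h2 : ∏ j ∈ range n, ((m : ℚ) + 1 + j) = (((m + 1).ascFactorial n : ℕ) : ℚ) := by
    rw [Nat.ascFactorial_eq_prod_range, Nat.cast_prod]
    exact prod_congr rfl fun j _ => by push_cast; ring
  rw [h2, Nat.ascFactorial_eq_factorial_mul_choose]
  push_cast
  ring

/-- **`B_n(m + ¼)` in product form** (`m ∈ ℕ`): `B_n(m+¼) = 2^{10n+4} (n!)² binom(m+n,n)² / ∏_{j≤n}(4m+4j+1)²` —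
the display «`B_n(t+¼) = 2^{(5s+10)n+2s+4}·f(t)`, `f(t) = (t+1)^{s+2}⋯(t+n)^{s+2} g(t)`, `g(t) = ∏_{k=0}^{n}(4t+4k+1)^{−(s+2)}`»
at `s = 0`, with `(t+1)⋯(t+n) = n!·binom(t+n,n)`. [cite: Lai2025TwoAdicZeta, Lemma 6.3 (proof, the displays for B_n(t+¼), f, g)] -/
theorem B_natCast_add_quarter (n m : ℕ) :
    B n ((m : ℚ) + 1 / 4) = (2 : ℚ) ^ (10 * n + 4) * ((n ! : ℚ) * ((m + n).choose n : ℚ)) ^ 2 /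
      (∏ j ∈ range (n + 1), (4 * (m : ℚ) + 4 * j + 1)) ^ 2 := by
  have hnum : ∏ j ∈ range n, ((m : ℚ) + 1 / 4 + 3 / 4 + j) = (n ! : ℚ) * ((m + n).choose n : ℚ) := by
    rw [← prod_range_add_one_add]
    exact prod_congr rfl fun j _ => by ring
  have hden : ∏ j ∈ range (n + 1), ((m : ℚ) + 1 / 4 + j) =
      (∏ j ∈ range (n + 1), (4 * (m : ℚ) + 4 * j + 1)) / (4 : ℚ) ^ (n + 1) := by
    calc ∏ j ∈ range (n + 1), ((m : ℚ) + 1 / 4 + j) = ∏ j ∈ range (n + 1), ((4 * (m : ℚ) + 4 * j + 1) / 4) :=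
          prod_congr rfl fun j _ => by ring
      _ = (∏ j ∈ range (n + 1), (4 * (m : ℚ) + 4 * j + 1)) / ∏ _j ∈ range (n + 1), (4 : ℚ) :=
          prod_div_distrib _ _
      _ = _ := by rw [prod_const, card_range]
  have hP : ∏ j ∈ range (n + 1), (4 * (m : ℚ) + 4 * j + 1) ≠ 0 := prod_ne_zero_iff.2 fun j _ => by positivity
  have h4 : ((4 : ℚ) ^ (n + 1)) ^ 2 = 2 ^ (4 * n + 4) := by
    rw [show (4 : ℚ) = 2 ^ 2 by norm_num, ← pow_mul, ← pow_mul]; ring_nf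
  rw [B, hnum, hden, div_pow, div_div_eq_mul_div, h4]
  congr 1
  ring

end Literature.NumberTheory.Irrationality.Lai2025TwoAdic
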